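import Summits.ResolutionOfSingularities.ResolutionOfSingularities.Theorems.WeightedInvariantLocalWeightedDropNCGameDecoratedWins

/-! # W4.3 `LocalWeightedDrop` — decorated winning regions from a POSITIONAL STRATEGY WITH NO INFINITE PLAY
[OURS · L1 W4.3 · crux stmt-ResolutionOfSingularities-8899 · author res-L1-w43-strat-1 (strategist, gen 9), for verbatim filing by a prover seat
(`--supports stmt-ResolutionOfSingularities-8899 --as helper`); game bookkeeping only, nothing of any manuscript; AI-produced, gate-checked, weaker than
expert review.]

WHY.  `…NCGameDecoratedWins` composes regime theorems given in MEASURE form (`DWinsTo.of_measure`: an ordinal measure lowered at every answer).  The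
engines IN PRINT for the wild cores are not stated that way: Cossart–Piltant (arXiv:1412.0868, Def. 2.18 p.26, Def. 5.2 and Thm 5.1 p.58) prove that a
point is «resolved» by exhibiting an INDEPENDENT (= positional: the centre depends only on the point, not on the valuation) sequence of permissible
blowing ups which is FINITE ALONG EVERY VALUATION — their invariant `ι = (p, ω, κ)` may temporarily INCREASE along the way (p.58: «we may have
κ(xᵢ) > κ(x) for some i»).  This file is the dictionary entry turning such a statement into `DWinsTo`: a positional strategy on a class of decorated
states, every answer re-decorated inside the class or in the target, and NO INFINITE PLAY through non-target states of the class ⇒ every state of the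
class wins towards the target.  (The successor relation of the strategy is then well founded — Mathlib `wellFounded_iff_isEmpty_descending_chain` —
and its ordinal height `Acc.rank` is a measure for `DWinsTo.of_measure`.)  «No infinite play» is what «finite along every valuation» gives:
an infinite chain of local blow-ups is dominated by a valuation ring (tree: `BaseTreeFiniteKonig.exists_valuationSubring_subringDominates_chain`). -/

set_option linter.dupNamespace false -- mandated namespace of this single-conjunct summit

noncomputable section

namespace Summit.ResolutionOfSingularities.ResolutionOfSingularities.Theorems

namespace TameFourTupleDrop

open MvPowerSeries Literature.AlgebraicGeometry.Resolution

variable {k : Type} [Field k] {m : ℕ} {St : Type} {germ : St → MvPowerSeries (Fin (m + 1)) k}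

/-- **POSITIONAL STRATEGY WITH NO INFINITE PLAY ⇒ `DWinsTo`.**  Let `C` be a class of decorated states and `succ τ` the set of decorated successors
the strategy allows after its move at `τ`.  Suppose: from every non-target `τ ∈ C` some count move has, at every answer, a successor germ carried by a
member of `succ τ` (`hstep`); the allowed successors of non-target members of `C` lie in `C` or in the target (`hsucc`); and there is NO infinite
sequence of non-target members of `C` each an allowed successor of the previous one (`hfin`).  Then every member of `C` wins towards `Q`. -/
theorem DWinsTo.of_noInfinitePlay {Q : St → Prop} (C : Set St) (succ : St → Set St)
    (hstep : ∀ τ ∈ C, ¬ Q τ → ∃ (Φ : Fin (m + 1) → MvPowerSeries (Fin (m + 1)) k) (w : Fin (m + 1) → ℕ),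
      IsCountMove Φ w ∧ MoveClause (germ τ) Φ w (fun b' => ∃ τ' ∈ succ τ, germ τ' = b'))
    (hsucc : ∀ τ ∈ C, ¬ Q τ → ∀ τ' ∈ succ τ, Q τ' ∨ τ' ∈ C)
    (hfin : ∀ f : ℕ → St, (∀ n, f n ∈ C ∧ ¬ Q (f n) ∧ f (n + 1) ∈ succ (f n)) → False)
    {σ : St} (hσ : σ ∈ C) : DWinsTo germ Q σ := by
  classical
  -- the successor relation of the strategy through non-target members of `C` is well founded
  let r : St → St → Prop := fun τ' τ => τ ∈ C ∧ ¬ Q τ ∧ τ' ∈ succ τ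
  have hwf : WellFounded r := wellFounded_iff_isEmpty_descending_chain.mpr ⟨fun f => hfin f.1 f.2⟩
  -- its ordinal height (the rank of the accessibility proof) is a measure lowered at every allowed successor
  refine DWinsTo.of_measure C (fun τ => (hwf.apply τ).rank) (fun τ hτ hQ => ?_) hσ
  obtain ⟨Φ, w, hmv, hcl⟩ := hstep τ hτ hQ
  refine ⟨Φ, w, hmv, hcl.mono fun b' ⟨τ', hτ', hb'⟩ => ⟨τ', hb', ?_⟩⟩
  rcases hsucc τ hτ hQ τ' hτ' with hq | hC
  · exact Or.inl hq
  · exact Or.inr ⟨hC, (hwf.apply τ).rank_lt_of_rel (show r τ' τ from ⟨hτ, hQ, hτ'⟩)⟩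

/-- The same with the strategy given as FUNCTIONS: a move `(Φ τ, w τ)` and a re-decoration `dec τ b'` of every successor germ `b'`. -/
theorem DWinsTo.of_strategy {Q : St → Prop} (C : Set St)
    (Φ : St → Fin (m + 1) → MvPowerSeries (Fin (m + 1)) k) (w : St → Fin (m + 1) → ℕ) (dec : St → MvPowerSeries (Fin (m + 1)) k → St)
    (hdec : ∀ τ b', germ (dec τ b') = b')
    (hstep : ∀ τ ∈ C, ¬ Q τ → IsCountMove (Φ τ) (w τ) ∧ MoveClause (germ τ) (Φ τ) (w τ) (fun b' => Q (dec τ b') ∨ dec τ b' ∈ C))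
    (hfin : ∀ f : ℕ → St, (∀ n, f n ∈ C ∧ ¬ Q (f n) ∧
      ∃ b', (Q (dec (f n) b') ∨ dec (f n) b' ∈ C) ∧ f (n + 1) = dec (f n) b') → False)
    {σ : St} (hσ : σ ∈ C) : DWinsTo germ Q σ := by
  classical
  refine DWinsTo.of_noInfinitePlay C (fun τ => {τ' | ∃ b', (Q (dec τ b') ∨ dec τ b' ∈ C) ∧ τ' = dec τ b'}) (fun τ hτ hQ => ?_)
    (fun τ _ _ τ' ⟨b', hb', hτ'⟩ => by rw [hτ']; exact hb') (fun f hf => hfin f fun n => ⟨(hf n).1, (hf n).2.1, (hf n).2.2⟩) hσ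
  obtain ⟨hmv, hcl⟩ := hstep τ hτ hQ
  exact ⟨Φ τ, w τ, hmv, hcl.mono fun b' hb' => ⟨dec τ b', ⟨b', hb', rfl⟩, hdec τ b'⟩⟩

end TameFourTupleDrop

end Summit.ResolutionOfSingularities.ResolutionOfSingularities.Theorems
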